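import Literature.AlgebraicGeometry.Motives.AbelianVarietyInducedActionProjectionFormula
import Literature.AlgebraicGeometry.Motives.AbelianVarietyInducedActionMackey
import HarnessLib

/-!
# `Ind_H^G (Y, α)` exists unconditionally: the induced action on the biproduct `⨁_{G/H} Y`, and the permutation and
# twisted permutation actions on `⨁_T Y`

The induced-action series (`Motives/AbelianVarietyInducedAction*`) is phrased for an arbitrary bicone `b` over `(Y)_{t ∈ T}` with
`Σ_t π_t ≫ ι_t = 𝟙` (`hb`).  The category `AbelianVariety K` has finite biproducts, and Mathlib's chosen biproduct bicone
`biproduct.bicone` satisfies `hb` (`biproduct.total`); this file records the resulting HYPOTHESIS-FREE existence statements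
(theorems only, no definition):

* **`exists_inducedAction_biproduct`** — for every subgroup `H ≤ G` of finite index and every action `α : H → End Y` there is an
  action `ρ` of `G` on the abelian variety `⨁_{σ ∈ G/H} Y` permuting the summands along `G/H` (`ι_σ ρ(g) π_τ = 0` for `τ ≠ gσ`)
  with stabiliser action `ι_H ρ(h) π_H = α(h)`: **the induced `G`-variety `Ind_H^G (Y, α)` exists** (Serre Thm. 11), and all
  results of the series apply to it with `b = biproduct.bicone _`, `t₀ = H ∈ G/H`, `Stab(t₀) = H` (`MulAction.stabilizer_quotient`);
* **`exists_permAction_biproduct`**, **`exists_twistedPermAction_biproduct`** — the permutation action `ι_t ρ(g) = ι_{gt}`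
  (`Y ⊗ ℤ[T]`) and the twisted permutation action `ι_t ρ(g) = β(g) ι_{gt}` (`β ⊗ ℤ[T]`) on `⨁_{t ∈ T} Y` for every finite `G`-set `T`;
* **`dim_biproduct_quotient_eq`** — `dim ⨁_{G/H} Y = [G : H] · dim Y`.

## References

* [SerreLinearRepresentations1977] J.-P. Serre, *Linear Representations of Finite Groups*, GTM 42 (1977): §3.3 Thm. 11
  (existence and uniqueness of induced representations), Examples 1, 2, 5.  Held:
  `book:serre1977-linear-representations-finite-groups`, PDF pp. 30–31 read 2026-08-28.
* [MumfordAV1970] D. Mumford, *Abelian Varieties* (1970), §19 (p. 173: products of abelian varieties and their homomorphisms).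
* [JordanEtAl2018] B. W. Jordan et al., *Abelian varieties isogenous to a power of an elliptic curve*, Compos. Math. 154 (2018),
  §4.1 (`M ⊗_R E`, `𝓗𝓞𝓜_R(M, E)` for finitely presented modules).
-/

noncomputable section

open CategoryTheory CategoryTheory.Limits MulAction
open Literature.NumberTheory.DiophantineGeometry

universe u

namespace Literature.AlgebraicGeometry.Motives

namespace AbelianVariety

namespace Imprimitive

variable {K : Type u} [Field K] {Y : AbelianVariety K} {G : Type} [Group G]

/-- **`Ind_H^G (Y, α)` exists (Serre's Theorem 11 for abelian varieties, unconditional form)**: for a subgroup `H ≤ G` of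
finite index and an action `α : H → End Y`, the biproduct `X = ⨁_{σ ∈ G/H} Y` carries an action `ρ : G → End X` permuting the
summands along `G/H` whose stabiliser action on the summand `Y_H` is `α` (`exists_inducedAction_quotient` for Mathlib's biproduct
bicone, `Σ_σ π_σ ≫ ι_σ = 𝟙` being `biproduct.total`). [cite: SerreLinearRepresentations1977, §3.3 Thm. 11 (existence) and Example 1] -/
theorem exists_inducedAction_biproduct (H : Subgroup G) [Fintype (G ⧸ H)] (α : H →* End Y) :
    ∃ ρ : G →* End (⨁ fun _ : G ⧸ H ↦ Y),
      (∀ (g : G) (σ τ : G ⧸ H), g • σ ≠ τ →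
        biproduct.ι (fun _ : G ⧸ H ↦ Y) σ ≫ End.asHom (ρ g) ≫ biproduct.π (fun _ : G ⧸ H ↦ Y) τ = 0) ∧
      ∀ h : H, biproduct.ι (fun _ : G ⧸ H ↦ Y) ((1 : G) : G ⧸ H) ≫ End.asHom (ρ h) ≫
        biproduct.π (fun _ : G ⧸ H ↦ Y) ((1 : G) : G ⧸ H) = End.asHom (α h) :=
  exists_inducedAction_quotient H (biproduct.bicone fun _ : G ⧸ H ↦ Y) α biproduct.total

/-- **The permutation action on `⨁_{t ∈ T} Y` exists** for every finite `G`-set `T`: `ι_t ρ(g) = ι_{g t}` (`Y ⊗ ℤ[T]`; the tree's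
`exists_permAction` for the biproduct bicone). [cite: SerreLinearRepresentations1977, §3.3 Example 2] [cite: JordanEtAl2018, §4.1] -/
theorem exists_permAction_biproduct {T : Type} [Fintype T] [MulAction G T] :
    ∃ ρ : G →* End (⨁ fun _ : T ↦ Y),
      ∀ (g : G) (t : T), biproduct.ι (fun _ : T ↦ Y) t ≫ End.asHom (ρ g) = biproduct.ι (fun _ : T ↦ Y) (g • t) :=
  exists_permAction (biproduct.bicone fun _ : T ↦ Y) biproduct.total

/-- **The twisted permutation action `β ⊗ ℤ[T]` on `⨁_{t ∈ T} Y` exists** for every finite `G`-set `T` and action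
`β : G → End Y`: `ι_t ρ(g) = β(g) ι_{g t}`. [cite: SerreLinearRepresentations1977, §3.3 Example 5 and Remark (3)] -/
theorem exists_twistedPermAction_biproduct {T : Type} [Fintype T] [MulAction G T] (β : G →* End Y) :
    ∃ ρ : G →* End (⨁ fun _ : T ↦ Y), ∀ (g : G) (t : T),
      biproduct.ι (fun _ : T ↦ Y) t ≫ End.asHom (ρ g) = End.asHom (β g) ≫ biproduct.ι (fun _ : T ↦ Y) (g • t) :=
  exists_twistedPermAction (biproduct.bicone fun _ : T ↦ Y) β biproduct.total

/-- **`dim ⨁_{G/H} Y = [G : H] · dim Y`** ("`dim V = (G : H) dim W`"). [cite: SerreLinearRepresentations1977, §3.3 Definition (ii)] -/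
theorem dim_biproduct_quotient_eq (H : Subgroup G) [Fintype (G ⧸ H)] :
    (⨁ fun _ : G ⧸ H ↦ Y).dim = H.index * Y.dim := by
  have h := dim_eq_index_stabilizer_mul (G := G) (biproduct.bicone fun _ : G ⧸ H ↦ Y) biproduct.total ((1 : G) : G ⧸ H)
  rw [stabilizer_quotient] at h
  exact h

end Imprimitive

end AbelianVariety

end Literature.AlgebraicGeometry.Motives
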